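/-
Copyright: cell `pub-ymgap` (HUMAN RULING D-0062), Track A of `YM-PLAN.md`, DAG node N20 (= NE7b); R134 acceleration seat
`pub-ymgap-dag-n20-c` (strategy s1, generation 22), module 59.  Released under the licence of the surrounding project.
-/
import Summits.QuantumFields.YangMills.Theorems.BalabanUVNodesN20LCSChiClassSocket
import HarnessLib

/-!
# YM-DAG node N20 (= NE7b), row s1, module 59: THE REGULARITY LETTER BY ENERGY COMPARISON — every minimiser of the (2.16) problem of
# record at data `ε″`-small on `□^{∼4}` is `√(N·n⋆_k)·ε″`-small on `{p ⊂ □^{∼1}}`, hence (T♮) ∕ `hreg` HOLD OUTRIGHT at every pinned level for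
# `B ≥ √(N·n⋆_k)·L^{2(k+1)}` (a LEVEL-DEPENDENT constant; the level-uniform `B` is [Balaban1985Variational] Thm 1 (8), K0's pen)

Track A of `YM-PLAN.md` (cell `pub-ymgap`, HUMAN RULING D-0062), node **N20** = spine estimate NE7b (`T4WeightBudget.RelWeightBound`, NOT
PRINTED, NOT PROVED).  Seat `pub-ymgap-dag-n20-c` (R134, s1), generation 22, module 59.  Kernel theorems only: 0 `def`, 0 `sorry`, standard
axioms; COUNT-NEUTRAL.  Composition BY NAME of dag-n12-c's `B15Prop1GradientFromNearValue.isMinimizer_pinned` ([III] (1.12) *«U = V₀ on Ω₁ᶜ»*: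
a minimiser of the (2.12) problem for `𝐁_k(Z)` and data `M˙(W)` IS `W` on the bonds leaving `Ω₁(Z)`), r11∕r12's `B14.Eq213DetSet` ((2.13): `Bj`, `maxDomT`,
the printed distance condition `dist_maxDomT`), p23's `B16Sect1Wilson` (`A = A(ζ₀) + A(1 − ζ₀)`, (1.15) [LF-II]), this lineage's modules 46∕49∕50∕55∕56, and the
cell's `SU(N)` trace inequalities `1 − Re tr ≤ ½|· − 1|²`, `|· − 1|² ≤ 2N(1 − Re tr)` ([Balaban1985UV3] (11)).  Nothing is re-declared.

THE QUESTION.  After modules 46–58 the s1 instance (`PointwiseExtraction ∧ LocCondStability` for Bałaban's label tower) is displayed modulo (W♮) (the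
(A1c) wall) and ONE regularity sentence in four equivalent dresses, `hreg` (18–45) ⇔ (T♮) (46 §4 ∕ 49 §3: «every minimiser `U₀` of the (2.16) problem of
record at `c` — class `{PlaqSmall (εreg·η_{k+1}²)}`, determining set `𝐁_{k+1}(□_c^{∼4})`, datum `M˙(Q_{k+1}^{s*}V′)` — whose `V′` is `ε″`-small on the
scale-`(k+1)` plaquettes sourced in `□_c^{∼4}` is `ε_{k+1}η_{k+1}²`-small on `{p ⊂ □_c^{∼1}}`», `ε″ = ε_{k+1}∕B`) ⇐ (T♭) (55) ⇐ (T♯) (56).  HOME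
`N20-S1-RESIDUAL.md` §(T♮) files it as [Balaban1985Variational] Thm 1 (9) for the LOCAL problem (K0's pen); g12–g21 asked for a LEVEL-UNIFORM `B` and
found no door.  THIS MODULE proves it with a LEVEL-DEPENDENT constant by ENERGY COMPARISON WITH THE DATUM'S OWN BOTTOM LAYER `W := Q_{k+1}^{s*}V′`:
(i) `U₀ = W` on every bond leaving `Ω₁ := maxDomT M₁ □^{∼4} 1` (`isMinimizer_pinned`), so both have the same FAR action (§2); (ii) `W` is ADMISSIBLE —
its averages ARE the datum, its near plaquettes are `1` or `V′(∂q̄)`, `q̄ ⊂ (□^{∼4})^{(k+1)}` (module 55 layer `0`; §1: a plaquette meeting `Ω₁` lies inside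
`□^{∼4}`, *«dist(Ω₁, Ω₀ᶜ) ≥ LM₁»*), `< ε″ ≤ εreg·η²`, its far plaquettes are `U₀`'s; (iii) hence `near(U₀) ≤ near(W) < ½ε″²·#plaqsOf Ω₁ ≤ ½ε″²·n⋆_k`,
`n⋆_k := d²·(9·sideχ_k)^d` (module 50's counting); (iv) `p ⊂ □^{∼1} ⊆ Ω₁` (module 56 §1) is a near plaquette, so
`|U₀(∂p) − 1|² ≤ 2N(1 − Re tr U₀(∂p)) ≤ 2N·near(U₀) < N·n⋆_k·ε″²` — ★★★ `plaqSmallOn_of_isMinimizer_crude`; (v) with `ε″ = ε_{k+1}∕B` this is (T♮)'s conclusion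
as soon as `√(N·n⋆_k) ≤ B·η_{k+1}²`, i.e. `B ≥ B_k := √(N·n⋆_k)·L^{2(k+1)}` (★★★ `hThm1_of_crude`, the EXACT binder shape of 52–56's `hThm1`; degenerate regime
`εreg ≤ ε_{k+1}` by module 49 §3), whence `hreg` at the canonical regions (★★ `hreg_canon_of_crude`).

WHAT THIS SETTLES AND WHAT IT DOES NOT (located, honest).  SETTLED: the regularity letter of the lineage (`hreg` ∕ (T♮) ∕ (T♭) ∕ (T♯)) is a THEOREM at every
pinned level for `B ≥ B_k`; the regime (R) of modules 47–53 absorbs ANY `B > 0`, so every fixed-`J` display of 48–56 loses (T) at the price `B ↦ max_{j∈J} B_j`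
inside (R) (module 60).  NOT SETTLED, EXACTLY LOCATED: `B_k = √N·d·(9·L^{k+2}M₂R_{k+1})^{d∕2}·L^{2(k+1)} ~ L^{4k}` is NOT level-uniform — the `η²` REGULARITY
GAIN of [Balaban1985Variational] Thm 1 (8) (`B = B₃(d, L)` uniform in `k`, torus, coupling) is what energy comparison cannot see (sup traded for the sum over
`O((9·sideχ_k)^d)` near plaquettes); with `B_J ~ L^{4·max J}` the threshold of (R) (`4N·B²·(κ + log m_j∕δ) ≤ p₀(g_{j+1})²`, module 52) holds only for
`g_{j+1} ≤ g⋆(J)` shrinking in `max J` (and wants `p₀ > 2r` through `R_{k+1}` inside `B_k`): GAINFUL AT FIXED DEPTH ONLY — the standing of dag-n20-d's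
by-value (W)-twin (module 36), now on the (T) side.  The level-uniform `B` stays K0's [Balaban1985Variational] Thm 1; (W♮) at `j ≥ 1` stays THE wall.

HONEST FRAMING.  Bookkeeping + two trace inequalities + one energy comparison; nothing of Bałaban's asserted; NE7b NOT PRINTED ∕ NOT PROVED; (α)-instance
0∕1; N20 NOT discharged; typed 28∕28, count untouched; one finite four-torus at fixed `ε` — NOT ℝ⁴, NOT infinite volume, NOT OS, NOT a mass gap, NOT Clay.

References: T. Bałaban, CMP 119 (1988) 243–285 [Balaban1988Convergent] ((1.12) p.248, (2.12)–(2.13) pp.256–257, (2.16)–(2.17) p.257, (3.2) p.265); CMP 102 (1985)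
277–309 [Balaban1985Variational] ((7) p.278, Thm 1 (8)–(9) p.279); CMP 122 (1989) 355–392 [Balaban1989LargeFieldII] ((1.15) p.359); CMP 102 (1985) 255–275 [Balaban1985UV3] ((11) p.258).
-/

set_option autoImplicit false

noncomputable section

open scoped BigOperators

namespace Summit.QuantumFields.YangMills.BalabanUVNodes.N20LCSMinimiserEnergyComparison

open MeasureTheory
open Literature.MathematicalPhysics.QuantumFieldTheory.Balaban1983to89
open Literature.MathematicalPhysics.QuantumFieldTheory.Balaban1983to89.T4Continuum
open Literature.MathematicalPhysics.QuantumFieldTheory.Balaban1983to89.Node00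
open B15DeterminingSets B14.Eq213DetSet B14.Eq213MaximalDomains B15Eq112TorusCover B14DomainGeom
open Literature.MathematicalPhysics.QuantumFieldTheory.BalabanImbrieJaffe1984to88.BIJ85Eq453GaugeField (qsstarGIter0)
open B15Prop1Carrier (plaqsInside)
open B8Eq17ClassAkV1 (plaqsOf plaqsOf_mono)
open B16Sect1Wilson (wilsonLoc eq115)
open B15Prop1GradientFromNearValue (isMinimizer_pinned plaqHol_congr_of_not_mem_plaqsOf wilsonLoc_congr)
open Summit.QuantumFields.YangMills.BalabanUVNodes.N20LCSTorusCounting (card_filter_plaq_le card_filter_embIter_mem_cubeEnl_le)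
open Summit.QuantumFields.YangMills.BalabanUVNodes.N20LCSChiClassSocket (cubeEnl_one_subset_maxDomT_top)
open Summit.QuantumFields.YangMills.BalabanUVNodes.N20LCSDatumAllLayers (plaqSmallOn_layers_datum_of_top)
open Summit.QuantumFields.YangMills.BalabanUVNodes.N20LCSCanonicalRegion (hThm1_of_le_epsOfRecord hreg_canon_of_regularity)

/-! ## §1  Geometry: a plaquette meeting `Ω₁(Z)` lies inside `Z`; `{p ⊂ □^{∼1}}` are near plaquettes; the near count -/

section Geometry

variable {P : Params}

/-- Sup-distance `≤ t` between any two corners `x + a e_μ + b e_ν`, `a, b ∈ {0, t}`, `μ ≠ ν` (dag-n12-c's private `within_corner`, re-proved). [folklore] -/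
private theorem within_corner {d : ℕ} (x : Pt d) {μ ν : Fin d} (hne : μ ≠ ν) {t : ℤ} (ht : 0 ≤ t) {a b a' b' : ℤ}
    (ha : a = 0 ∨ a = t) (hb : b = 0 ∨ b = t) (ha' : a' = 0 ∨ a' = t) (hb' : b' = 0 ∨ b' = t) :
    Within t (x + Pi.single μ a + Pi.single ν b) (x + Pi.single μ a' + Pi.single ν b') := by
  intro i
  simp only [Pi.add_apply]
  rw [abs_le]
  by_cases hμ : i = μ
  · subst hμ
    rw [Pi.single_eq_same, Pi.single_eq_same, Pi.single_eq_of_ne hne, Pi.single_eq_of_ne hne]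
    rcases ha with ha | ha <;> rcases ha' with ha' | ha' <;> constructor <;> linarith
  · by_cases hν : i = ν
    · subst hν
      rw [Pi.single_eq_same, Pi.single_eq_same, Pi.single_eq_of_ne hμ, Pi.single_eq_of_ne hμ]
      rcases hb with hb | hb <;> rcases hb' with hb' | hb' <;> constructor <;> linarith
    · rw [Pi.single_eq_of_ne hμ, Pi.single_eq_of_ne hμ, Pi.single_eq_of_ne hν, Pi.single_eq_of_ne hν]
      constructor <;> linarith

/-- Weakening the radius of `Within`. [folklore] -/
private theorem within_mono {d : ℕ} {r r' : ℤ} (h : r ≤ r') {x y : Pt d} (hw : Within r x y) : Within r' x y :=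
  fun i => (hw i).trans h

/-- ★ **A PLAQUETTE MEETING `Ω₁(Z)` LIES INSIDE `Z`** — the four corners of a fine plaquette with a corner in `Ω₁(Z) = maxDomT M₁ Z 1` are within sup-distance
`1 ≤ LM₁ − 1` of that corner on the cover, hence in `Ω₀(Z) = Z` by the printed distance condition *«dist(Ω_n, Ωᶜ_{n−1}) ≧ LⁿξM₁»* (r11's `dist_maxDomT`;
torus divisibility `LᴶM₁ ∣ 2L^{m+K}` of the cube partitions, `1 ≤ J`; dag-n12-c's `printedPlaqsTop_maxDomT_subset_plaqsInside` is the same with the hull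
of `Ω₁`). [cite: Balaban1988Convergent, (2.13) pp.256–257] -/
theorem plaqsOf_maxDomT_one_subset_plaqsInside {M₁ : ℕ} (hM : 1 ≤ M₁) {Z : Set (Site P 0)} {J : ℕ}
    (hdiv : side P.L M₁ J ∣ P.sitesPerDir 0) (hJ : 1 ≤ J) :
    plaqsOf (maxDomT M₁ Z 1) ⊆ plaqsInside Z := by
  intro p hp
  set x : Pt P.d := lift P p.src with hxdef
  let q : ℤ → ℤ → Pt P.d := fun a b => x + Pi.single p.μ a + Pi.single p.ν b
  have hstep : ∀ {y : Pt P.d} {c : Site P 0}, cover P y = c → ∀ μ, cover P (y + Pi.single μ 1) = c.shift μ := by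
    intro y c hy μ
    have h := B15Prop1DatumSmall7AtZSequence.cover_add_single_pow (P := P) 0 (c := c) hy μ
    rwa [pow_zero] at h
  have hq00 : cover P (q 0 0) = p.src := by
    show cover P (x + Pi.single p.μ 0 + Pi.single p.ν 0) = _
    rw [Pi.single_zero, Pi.single_zero, add_zero, add_zero, hxdef, cover_lift]
  have hq10 : cover P (q 1 0) = p.src.shift p.μ := by
    show cover P (x + Pi.single p.μ 1 + Pi.single p.ν 0) = _
    rw [Pi.single_zero, add_zero, hstep (by rw [hxdef, cover_lift]) p.μ]
  have hq01 : cover P (q 0 1) = p.src.shift p.ν := by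
    show cover P (x + Pi.single p.μ 0 + Pi.single p.ν 1) = _
    rw [Pi.single_zero, add_zero, hstep (by rw [hxdef, cover_lift]) p.ν]
  have hq11 : cover P (q 1 1) = (p.src.shift p.μ).shift p.ν := by
    show cover P (x + Pi.single p.μ 1 + Pi.single p.ν 1) = _
    rw [hstep _ p.ν]
    rw [hstep (by rw [hxdef, cover_lift]) p.μ]
  have hne : p.μ ≠ p.ν := ne_of_lt p.hμν
  have h0 : ∃ a b, (a = 0 ∨ a = 1) ∧ (b = 0 ∨ b = 1) ∧ cover P (q a b) ∈ maxDomT M₁ Z (0 + 1) := by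
    rcases hp with h | h | h | h
    · exact ⟨0, 0, Or.inl rfl, Or.inl rfl, by rw [hq00]; exact h⟩
    · exact ⟨1, 0, Or.inr rfl, Or.inl rfl, by rw [hq10]; exact h⟩
    · exact ⟨0, 1, Or.inl rfl, Or.inr rfl, by rw [hq01]; exact h⟩
    · exact ⟨1, 1, Or.inr rfl, Or.inr rfl, by rw [hq11]; exact h⟩
  obtain ⟨a₀, b₀, ha₀, hb₀, hmem⟩ := h0
  have hside : (2 : ℤ) ≤ (side P.L M₁ (0 + 1) : ℤ) := by
    have hL : (2 : ℤ) ≤ P.L := by exact_mod_cast P.hL.2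
    have hM' : (1 : ℤ) ≤ M₁ := by exact_mod_cast hM
    have : (side P.L M₁ (0 + 1) : ℤ) = P.L * M₁ := by simp [side, Nat.cast_mul]
    rw [this]
    nlinarith
  have hW : ∀ a b, (a = 0 ∨ a = 1) → (b = 0 ∨ b = 1) → Within ((side P.L M₁ (0 + 1) : ℤ) - 1) (q a₀ b₀) (q a b) :=
    fun a b ha hb => within_mono (by linarith) (within_corner x hne zero_le_one ha₀ hb₀ ha hb)
  have H : ∀ a b, (a = 0 ∨ a = 1) → (b = 0 ∨ b = 1) → cover P (q a b) ∈ Z := fun a b ha hb => by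
    have h := dist_maxDomT hM hdiv hJ hmem (hW a b ha hb)
    rwa [maxDomT_zero] at h
  refine ⟨?_, ?_, ?_, ?_⟩
  · rw [← hq00]; exact H 0 0 (Or.inl rfl) (Or.inl rfl)
  · rw [← hq10]; exact H 1 0 (Or.inr rfl) (Or.inl rfl)
  · rw [← hq01]; exact H 0 1 (Or.inl rfl) (Or.inr rfl)
  · rw [← hq11]; exact H 1 1 (Or.inr rfl) (Or.inr rfl)

/-- **`{p ⊂ □^{∼1}}` ARE NEAR PLAQUETTES OF THE LOCAL PROBLEM**: `plaqInside (□^{∼1}) ⊆ plaqsOf (Ω₁(□^{∼4}))`, since `□^{∼1} ⊆ Ω₁(□^{∼4})` (module 56 §1 at the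
first maximal domain; layer width `LM₁ ≤ s`). [cite: Balaban1988Convergent, (2.13) pp.256–257, (2.16)–(2.17) p.257] -/
theorem plaqInside_cubeEnl_one_subset_plaqsOf {M₁ : ℕ} (hM : 1 ≤ M₁) {s : ℕ} (hts : side P.L M₁ 1 ≤ s) (a : Pt P.d) :
    plaqInside (cubeEnl P s a 1) ⊆ plaqsOf (maxDomT M₁ (cubeEnl P s a 4) 1) := fun _ hq =>
  plaqsOf_mono (cubeEnl_one_subset_maxDomT_top hM hts a) (plaqInside_subset_plaqsOf _ hq)

open Classical in
/-- **THE NEAR COUNT**: the plaquettes meeting `Ω₁(□_a^{∼4})` number at most `n⋆ = d²·(9s)^d` — they lie inside `□^{∼4}` (§1), are sourced there, and `□^{∼4}`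
has at most `(9s)^d` sites (module 50's seam-aware torus counting at scale `0`, `(2·4+1)·s = 9s`). [cite: Balaban1988Convergent, (2.16)–(2.17) p.257 (bookkeeping)] -/
theorem card_filter_plaqsOf_maxDomT_one_le {M₁ : ℕ} (hM : 1 ≤ M₁) {J : ℕ} (hdiv : side P.L M₁ J ∣ P.sitesPerDir 0) (hJ : 1 ≤ J)
    (s : ℕ) (a : Pt P.d) :
    (Finset.univ.filter fun q : Plaq P 0 => q ∈ plaqsOf (maxDomT M₁ (cubeEnl P s a 4) 1)).card ≤ P.d ^ 2 * (9 * s) ^ P.d := by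
  have h1 : (Finset.univ.filter fun q : Plaq P 0 => q ∈ plaqsOf (maxDomT M₁ (cubeEnl P s a 4) 1)) ⊆
      Finset.univ.filter fun q : Plaq P 0 => q.src ∈ cubeEnl P s a 4 := by
    intro q hq
    rw [Finset.mem_filter] at hq ⊢
    exact ⟨hq.1, (plaqsOf_maxDomT_one_subset_plaqsInside hM hdiv hJ hq.2).1⟩
  have h2 := card_filter_plaq_le (P := P) (j := 0) (fun x : Site P 0 => x ∈ cubeEnl P s a 4)
  have h3 : ((Finset.univ : Finset (Site P 0)).filter fun x => x ∈ cubeEnl P s a 4).card ≤ (9 * s) ^ P.d := by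
    have h := card_filter_embIter_mem_cubeEnl_le (P := P) (j := 0) (Nat.zero_le _) (s := s) (w := 4) (ℓ := 9 * s) (by ring) a
    exact h
  exact (Finset.card_le_card h1).trans (h2.trans (Nat.mul_le_mul_left _ h3))

end Geometry

/-! ## §2  Energy comparison with the datum's own bottom layer: the minimiser's NEAR action is at most the test field's -/

section Comparison

variable {P : Params} {G : Type*} [GaugeGroup G]

/-- **THE DATUM'S BOTTOM LAYER IS AN ADMISSIBLE COMPETITOR**: if `U₀` minimises the (2.12) problem with data `M˙(W)` and `W` lies in the class, then
`A(U₀) ≤ A(W)` — `M˙(W)` agrees with itself on every determining set. [cite: Balaban1988Convergent, (2.11)–(2.12) p.256] -/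
theorem wilsonAction4_le_of_isMinimizer_self {av : ∀ j, Averaging P j G} {reg : Set (GaugeField P 0 G)} {𝔹 : DetSet P}
    {W U₀ : GaugeField P 0 G} (hmin : IsMinimizer av reg 𝔹 (avgFamily av W) U₀) (hW : W ∈ reg) :
    wilsonAction4 U₀ ≤ wilsonAction4 W :=
  hmin.2.2 W hW (fun _ _ _ => rfl)

/-- **MINIMISER AND TEST FIELD HAVE ONE FAR ACTION** (`0 < k`, data `M˙(W)`): both read `W` on every bond leaving `Ω₁(Z)` ([III] (1.12) *«U = V₀ on Ω₁ᶜ»*,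
dag-n12-c's `isMinimizer_pinned`), and a plaquette off `plaqsOf Ω₁(Z)` reads only such bonds. [cite: Balaban1988Convergent, (1.12) p.248, (2.12)–(2.13) pp.256–257; Balaban1989LargeFieldII, (1.15) p.359] -/
theorem farValue_eq_of_isMinimizer_self {av : ∀ j, Averaging P j G} {reg : Set (GaugeField P 0 G)} {M₁ : ℕ} {Z : Set (Site P 0)} {k : ℕ}
    (hk0 : 0 < k) {W U₀ : GaugeField P 0 G} (hmin : IsMinimizer av reg (Bj M₁ Z k) (avgFamily av W) U₀) :
    wilsonLoc (fun p => 1 - (plaqsOf (maxDomT M₁ Z 1)).indicator (fun _ => (1 : ℝ)) p) U₀ =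
      wilsonLoc (fun p => 1 - (plaqsOf (maxDomT M₁ Z 1)).indicator (fun _ => (1 : ℝ)) p) W :=
  wilsonLoc_congr _ fun p hp =>
    plaqHol_congr_of_not_mem_plaqsOf (fun b hb => isMinimizer_pinned hk0 hmin b hb) fun hmem => hp (by
      simp only [Set.indicator_of_mem hmem, sub_self])

/-- ★★ **THE MINIMISER'S NEAR ACTION IS AT MOST THE TEST FIELD'S**: `Σ_{p ∈ plaqsOf Ω₁(Z)} (1 − Re tr U₀(∂p)) ≤ Σ_{p ∈ plaqsOf Ω₁(Z)} (1 − Re tr W(∂p))` for every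
minimiser `U₀` of the problem with data `M˙(W)`, `W` in the class, `0 < k` — total actions compare (admissibility of `W`), far actions agree, and
`A = A(ζ₀) + A(1 − ζ₀)` ([LF-II] (1.15)). [cite: Balaban1988Convergent, (2.12)–(2.13) pp.256–257; Balaban1989LargeFieldII, (1.15) p.359] -/
theorem nearValue_le_of_isMinimizer_self {av : ∀ j, Averaging P j G} {reg : Set (GaugeField P 0 G)} {M₁ : ℕ} {Z : Set (Site P 0)} {k : ℕ}
    (hk0 : 0 < k) {W U₀ : GaugeField P 0 G} (hmin : IsMinimizer av reg (Bj M₁ Z k) (avgFamily av W) U₀) (hW : W ∈ reg) :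
    wilsonLoc ((plaqsOf (maxDomT M₁ Z 1)).indicator fun _ => (1 : ℝ)) U₀ ≤ wilsonLoc ((plaqsOf (maxDomT M₁ Z 1)).indicator fun _ => (1 : ℝ)) W := by
  have htot := wilsonAction4_le_of_isMinimizer_self hmin hW
  rw [eq115 ((plaqsOf (maxDomT M₁ Z 1)).indicator fun _ => (1 : ℝ)) U₀, eq115 ((plaqsOf (maxDomT M₁ Z 1)).indicator fun _ => (1 : ℝ)) W,
    farValue_eq_of_isMinimizer_self hk0 hmin] at htot
  linarith

open Classical in
/-- Bookkeeping: the near action as a filtered sum, `A(1_{plaqsOf Y}, U) = Σ_{q ∈ plaqsOf Y} (1 − Re tr U(∂q))`. [cite: Balaban1989LargeFieldII, (1.1) p.356 (bookkeeping)] -/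
theorem wilsonLoc_indicator_eq_sum_filter {j : ℕ} (Y : Set (Site P j)) (U : GaugeField P j G) :
    wilsonLoc ((plaqsOf Y).indicator fun _ => (1 : ℝ)) U =
      ∑ q ∈ Finset.univ.filter (fun q : Plaq P j => q ∈ plaqsOf Y), ((1 : ℝ) - reTr (GaugeField.plaqHol U q)) := by
  unfold wilsonLoc
  rw [Finset.sum_filter]
  refine Finset.sum_congr rfl fun q _ => ?_
  by_cases hq : q ∈ plaqsOf Y
  · simp only [if_pos hq, Set.indicator_of_mem hq, one_mul]
  · simp only [if_neg hq, Set.indicator_of_notMem hq, zero_mul]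

open Classical in
/-- **ONE NEAR PLAQUETTE IS DOMINATED BY THE NEAR ACTION** (terms are nonnegative, `Re tr ≤ 1`). [cite: Balaban1989LargeFieldII, (1.1) p.356 (bookkeeping)] -/
theorem one_sub_reTr_le_nearValue {j : ℕ} (Y : Set (Site P j)) (U : GaugeField P j G) {q : Plaq P j} (hq : q ∈ plaqsOf Y) :
    1 - reTr (GaugeField.plaqHol U q) ≤ wilsonLoc ((plaqsOf Y).indicator fun _ => (1 : ℝ)) U := by
  rw [wilsonLoc_indicator_eq_sum_filter]
  refine Finset.single_le_sum (f := fun q : Plaq P j => (1 : ℝ) - reTr (GaugeField.plaqHol U q)) (fun q' _ => ?_)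
    (Finset.mem_filter.2 ⟨Finset.mem_univ _, hq⟩)
  have := GaugeGroup.reTr_le_one (GaugeField.plaqHol U q')
  linarith

end Comparison

/-! ## §3  `G = SU(N)`: every minimiser of the (2.16) problem of record is `√(N·n⋆_k)·ε″`-small on `{p ⊂ □^{∼1}}`; (T♮) and `hreg` for `B ≥ B_k` -/

section Crude

variable (F : T4Family) (N : ℕ) [NeZero N] (ν : Stage7Numerics) (p : B12.RunParams) (g : ℕ → ℝ)

open Classical in
/-- **THE TEST FIELD'S NEAR ACTION IS STRICTLY BELOW `½ε″²·#plaqsOf Ω₁`** whenever its near plaquettes are `ε″`-small and there is at least one of them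
(`1 − Re tr ≤ ½|· − 1|²` on `SU(N)`, [Balaban1985UV3] (11)). [cite: Balaban1985UV3, (11) p.258] -/
theorem nearValue_lt_of_plaqSmallOn {P : Params} (Y : Set (Site P 0)) {δ : ℝ} (W : GaugeField P 0 (SU N))
    (hW : ∀ q ∈ plaqsOf Y, dist1 (GaugeField.plaqHol W q) < δ) {q₀ : Plaq P 0} (hq₀ : q₀ ∈ plaqsOf Y) :
    wilsonLoc ((plaqsOf Y).indicator fun _ => (1 : ℝ)) W <
      1 / 2 * δ ^ 2 * ((Finset.univ.filter fun q : Plaq P 0 => q ∈ plaqsOf Y).card : ℝ) := by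
  rw [wilsonLoc_indicator_eq_sum_filter]
  have hlt : ∀ q ∈ Finset.univ.filter (fun q : Plaq P 0 => q ∈ plaqsOf Y), (1 : ℝ) - reTr (GaugeField.plaqHol W q) < 1 / 2 * δ ^ 2 := by
    intro q hq
    have hm : q ∈ plaqsOf Y := (Finset.mem_filter.1 hq).2
    have h1 := B10Eq5RegularAction.one_sub_reTr_le_specialUnitaryGroup (GaugeField.plaqHol W q)
    have h2 : dist1 (GaugeField.plaqHol W q) < δ := hW q hm
    have h0 := GaugeGroup.dist1_nonneg (GaugeField.plaqHol W q)
    have h3 : dist1 (GaugeField.plaqHol W q) ^ 2 < δ ^ 2 := by nlinarith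
    linarith
  calc ∑ q ∈ Finset.univ.filter (fun q : Plaq P 0 => q ∈ plaqsOf Y), ((1 : ℝ) - reTr (GaugeField.plaqHol W q))
      < ∑ _q ∈ Finset.univ.filter (fun q : Plaq P 0 => q ∈ plaqsOf Y), 1 / 2 * δ ^ 2 :=
        Finset.sum_lt_sum_of_nonempty ⟨q₀, Finset.mem_filter.2 ⟨Finset.mem_univ _, hq₀⟩⟩ hlt
    _ = 1 / 2 * δ ^ 2 * ((Finset.univ.filter fun q : Plaq P 0 => q ∈ plaqsOf Y).card : ℝ) := by
        rw [Finset.sum_const, nsmul_eq_mul, mul_comm]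

open Classical in
/-- ★★★ **EVERY MINIMISER OF THE (2.16) PROBLEM OF RECORD IS `√(N·n⋆_k)·ε″`-SMALL ON `{p ⊂ □^{∼1}}`** (`n⋆_k = d²·(9·sideχ_k)^d`): for every χ_{k+1}-cube `c`,
every `V′` that is `ε″`-small (`0 < ε″`) on the scale-`(k+1)` plaquettes sourced in `□_c^{∼4}`, and EVERY minimiser `U₀` over def-R's class
`{PlaqSmall (εreg·η_{k+1}²)}` with determining set `𝐁_{k+1}(□_c^{∼4})` and datum `M˙(Q_{k+1}^{s*}V′)`, provided the test field is in the class on its near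
plaquettes (`ε″ ≤ εreg·η_{k+1}²`): `|U₀(∂p) − 1| < √(N·n⋆_k)·ε″` for `p ⊂ □_c^{∼1}` — energy comparison with `Q_{k+1}^{s*}V′` (§2), whose near plaquettes are
`1` or `V′(∂q̄)` (module 55, layer `0`; §1), plus `|· − 1|² ≤ 2N(1 − Re tr)` on `SU(N)`.  Letters: `1 ≤ M₁`, torus divisibility `L^{k+1}M₁ ∣ 2L^{m+K}`,
`LM₁ ≤ sideχ_k`, range `k + 1 ≤ m + K`.  NO regularity GAIN `η²`: that is [Balaban1985Variational] Thm 1 (8), not claimed.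
[cite: Balaban1988Convergent, (2.12)–(2.13) pp.256–257, (2.16)–(2.17) p.257; Balaban1985UV3, (11) p.258; Balaban1985Variational, (7) p.278] -/
theorem plaqSmallOn_of_isMinimizer_crude {k : ℕ} (hk : k + 1 ≤ (F.P p.K).m + (F.P p.K).K) (hM : 1 ≤ ν.M₁)
    (hdiv : side (F.P p.K).L ν.M₁ (k + 1) ∣ (F.P p.K).sitesPerDir 0) (hsz : side (F.P p.K).L ν.M₁ 1 ≤ sideχ F ν p g k)
    (c : Iχ F ν p g k) {ε'' : ℝ} (hε : 0 < ε'') (hεreg : ε'' ≤ ν.εreg * (F.P p.K).eta (k + 1) ^ 2)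
    {V' : GaugeField (F.P p.K) (k + 1) (SU N)} {U₀ : GaugeField (F.P p.K) 0 (SU N)}
    (hmin : IsMinimizer (avOfRecord F N p.K) {U | PlaqSmall (ν.εreg * (F.P p.K).eta (k + 1) ^ 2) U}
      (Bj ν.M₁ (cubeEnl (F.P p.K) (sideχ F ν p g k) c 4) (k + 1)) (avgFamily (avOfRecord F N p.K) (qsstarGIter0 (k + 1) V')) U₀)
    (hV' : ∀ p' : Plaq (F.P p.K) (k + 1), embIter (k + 1) p'.src ∈ cubeEnl (F.P p.K) (sideχ F ν p g k) c 4 →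
      dist1 (GaugeField.plaqHol V' p') < ε'') :
    PlaqSmallOn (plaqInside (cubeEnl (F.P p.K) (sideχ F ν p g k) c 1))
      (Real.sqrt ((N : ℝ) * (((F.P p.K).d ^ 2 * (9 * sideχ F ν p g k) ^ (F.P p.K).d : ℕ) : ℝ)) * ε'') U₀ := by
  intro q hq
  have hk0 : 0 < k + 1 := Nat.succ_pos k
  -- the test field `W := Q_{k+1}^{s*}V′` is `ε″`-small on the plaquettes inside `Y := □^{∼4}` (module 55, layer 0)
  have hWsmall : PlaqSmallOn (plaqsInside (cubeEnl (F.P p.K) (sideχ F ν p g k) c 4)) ε'' (qsstarGIter0 (k + 1) V') := by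
    have h := plaqSmallOn_layers_datum_of_top F N ν p g hk c hε hV' (i := 0) (Nat.zero_le _)
    simpa only [avgFamily, Averaging.iter, pts_zero, id_eq] using h
  -- near plaquettes lie inside `□^{∼4}`
  have hsub : plaqsOf (maxDomT ν.M₁ (cubeEnl (F.P p.K) (sideχ F ν p g k) c 4) 1) ⊆
      plaqsInside (cubeEnl (F.P p.K) (sideχ F ν p g k) c 4) := plaqsOf_maxDomT_one_subset_plaqsInside hM hdiv hk0
  have hWnear : ∀ q' ∈ plaqsOf (maxDomT ν.M₁ (cubeEnl (F.P p.K) (sideχ F ν p g k) c 4) 1),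
      dist1 (GaugeField.plaqHol (qsstarGIter0 (k + 1) V') q') < ε'' := fun q' hq' => hWsmall q' (hsub hq')
  -- the plaquette `q ⊂ □^{∼1}` is a near plaquette
  have hqnear : q ∈ plaqsOf (maxDomT ν.M₁ (cubeEnl (F.P p.K) (sideχ F ν p g k) c 4) 1) :=
    plaqInside_cubeEnl_one_subset_plaqsOf hM hsz _ hq
  -- the test field is in the class: near plaquettes by smallness, far plaquettes are the minimiser's (pinning)
  have hpin : ∀ b : PBond (F.P p.K) 0, b.src ∉ maxDomT ν.M₁ (cubeEnl (F.P p.K) (sideχ F ν p g k) c 4) 1 →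
      U₀ b = qsstarGIter0 (k + 1) V' b := fun b hb => isMinimizer_pinned hk0 hmin b hb
  have hWreg : qsstarGIter0 (k + 1) V' ∈ {U : GaugeField (F.P p.K) 0 (SU N) | PlaqSmall (ν.εreg * (F.P p.K).eta (k + 1) ^ 2) U} := by
    intro q'
    by_cases hq' : q' ∈ plaqsOf (maxDomT ν.M₁ (cubeEnl (F.P p.K) (sideχ F ν p g k) c 4) 1)
    · exact (hWnear q' hq').trans_le hεreg
    · rw [← plaqHol_congr_of_not_mem_plaqsOf hpin hq']
      exact hmin.1 q'
  -- energy comparison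
  have hnear := nearValue_le_of_isMinimizer_self hk0 hmin hWreg
  have hlt := nearValue_lt_of_plaqSmallOn N (maxDomT ν.M₁ (cubeEnl (F.P p.K) (sideχ F ν p g k) c 4) 1) (qsstarGIter0 (k + 1) V')
    hWnear hqnear
  have hcard : ((Finset.univ.filter fun q' : Plaq (F.P p.K) 0 =>
      q' ∈ plaqsOf (maxDomT ν.M₁ (cubeEnl (F.P p.K) (sideχ F ν p g k) c 4) 1)).card : ℝ) ≤
      (((F.P p.K).d ^ 2 * (9 * sideχ F ν p g k) ^ (F.P p.K).d : ℕ) : ℝ) := by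
    exact_mod_cast card_filter_plaqsOf_maxDomT_one_le hM hdiv hk0 (sideχ F ν p g k) (c : Pt (F.P p.K).d)
  have hone := one_sub_reTr_le_nearValue (maxDomT ν.M₁ (cubeEnl (F.P p.K) (sideχ F ν p g k) c 4) 1) U₀ hqnear
  have hsq := B10Eq71TorusLocal.dist1_sq_le_specialUnitaryGroup (GaugeField.plaqHol U₀ q)
  have hd0 := GaugeGroup.dist1_nonneg (GaugeField.plaqHol U₀ q)
  have hε2 : 0 ≤ 1 / 2 * ε'' ^ 2 := by positivity
  have hN' : (0 : ℝ) < N := by exact_mod_cast Nat.pos_of_ne_zero (NeZero.ne N)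
  -- `dist1² ≤ 2N(1 − Re tr) ≤ 2N·near(U₀) ≤ 2N·near(W) < 2N·½ε″²·#near ≤ N·n⋆·ε″²`
  have hchain : dist1 (GaugeField.plaqHol U₀ q) ^ 2 <
      (N : ℝ) * (((F.P p.K).d ^ 2 * (9 * sideχ F ν p g k) ^ (F.P p.K).d : ℕ) : ℝ) * ε'' ^ 2 := by
    have h2 := hlt.trans_le (mul_le_mul_of_nonneg_left hcard hε2)
    nlinarith
  have hrhs : (N : ℝ) * (((F.P p.K).d ^ 2 * (9 * sideχ F ν p g k) ^ (F.P p.K).d : ℕ) : ℝ) * ε'' ^ 2 =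
      (Real.sqrt ((N : ℝ) * (((F.P p.K).d ^ 2 * (9 * sideχ F ν p g k) ^ (F.P p.K).d : ℕ) : ℝ)) * ε'') ^ 2 := by
    rw [mul_pow (Real.sqrt _) ε'' 2, Real.sq_sqrt (by positivity)]
  rw [hrhs] at hchain
  exact lt_of_pow_lt_pow_left₀ 2 (by positivity) hchain

/-- ★★★ **(T♮) HOLDS OUTRIGHT FOR `B ≥ B_k := √(N·n⋆_k)·L^{2(k+1)}`** — the EXACT binder shape of modules 49 §3 ∕ 52–56's `hThm1` at level `k`, cube `c`, with
`ε″ = ε_{k+1}∕B`: in the degenerate regime `εreg ≤ ε_{k+1}` by class membership alone (module 49 §3 `hThm1_of_le_epsOfRecord`); otherwise by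
`plaqSmallOn_of_isMinimizer_crude`, since `√(N·n⋆_k)·(ε_{k+1}∕B) ≤ ε_{k+1}·η_{k+1}²` iff `√(N·n⋆_k) ≤ B·η_{k+1}²`, and then `ε″ ≤ ε_{k+1}η² < εreg·η²` (the near
set is non-empty, so `n⋆_k ≥ 1`).  `B_k ~ L^{4k}` is LEVEL-DEPENDENT: the level-uniform constant is [Balaban1985Variational] Thm 1 (8), NOT claimed.
[cite: Balaban1985Variational, Thm 1 (8)–(9) p.279; Balaban1988Convergent, (2.12)–(2.13) pp.256–257, (2.16)–(2.17) p.257] -/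
theorem hThm1_of_crude {k : ℕ} (hk : k + 1 ≤ (F.P p.K).m + (F.P p.K).K) (hM : 1 ≤ ν.M₁)
    (hdiv : side (F.P p.K).L ν.M₁ (k + 1) ∣ (F.P p.K).sitesPerDir 0) (hsz : side (F.P p.K).L ν.M₁ 1 ≤ sideχ F ν p g k)
    {B : ℝ} (hB0 : 0 < B) (hεk : 0 < epsOfRecord ν g (k + 1))
    (hB : Real.sqrt ((N : ℝ) * (((F.P p.K).d ^ 2 * (9 * sideχ F ν p g k) ^ (F.P p.K).d : ℕ) : ℝ)) ≤ B * (F.P p.K).eta (k + 1) ^ 2)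
    (c : Iχ F ν p g k) :
    ∀ (V' : GaugeField (F.P p.K) (k + 1) (SU N)) (U₀ : GaugeField (F.P p.K) 0 (SU N)),
      IsMinimizer (avOfRecord F N p.K) {U | PlaqSmall (ν.εreg * (F.P p.K).eta (k + 1) ^ 2) U}
          (Bj ν.M₁ (cubeEnl (F.P p.K) (sideχ F ν p g k) c 4) (k + 1)) (avgFamily (avOfRecord F N p.K) (qsstarGIter0 (k + 1) V')) U₀ →
      (∀ p' : Plaq (F.P p.K) (k + 1), embIter (k + 1) p'.src ∈ cubeEnl (F.P p.K) (sideχ F ν p g k) c 4 →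
        dist1 (GaugeField.plaqHol V' p') < epsOfRecord ν g (k + 1) / B) →
      PlaqSmallOn (plaqInside (cubeEnl (F.P p.K) (sideχ F ν p g k) c 1)) (epsOfRecord ν g (k + 1) * (F.P p.K).eta (k + 1) ^ 2) U₀ := by
  rcases le_or_gt ν.εreg (epsOfRecord ν g (k + 1)) with hdeg | hnd
  · exact hThm1_of_le_epsOfRecord F N ν p g k c hdeg _
  intro V' U₀ hmin hV' q hq
  set Λ : ℝ := Real.sqrt ((N : ℝ) * (((F.P p.K).d ^ 2 * (9 * sideχ F ν p g k) ^ (F.P p.K).d : ℕ) : ℝ)) with hΛ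
  have hη : 0 < (F.P p.K).eta (k + 1) ^ 2 := by
    have : 0 < (F.P p.K).eta (k + 1) := by
      unfold Params.eta
      exact pow_pos (inv_pos.2 (by exact_mod_cast (F.P p.K).L_pos)) _
    positivity
  have hε : 0 < epsOfRecord ν g (k + 1) / B := div_pos hεk hB0
  have hΛ0 : 0 ≤ Λ := Real.sqrt_nonneg _
  -- `Λ·(ε∕B) ≤ ε·η²`
  have hmain : Λ * (epsOfRecord ν g (k + 1) / B) ≤ epsOfRecord ν g (k + 1) * (F.P p.K).eta (k + 1) ^ 2 := by
    rw [mul_div_assoc', div_le_iff₀ hB0]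
    nlinarith
  -- `Λ ≥ 1` because the near set contains `q`, so `ε∕B ≤ ε·η² < εreg·η²`
  have hk0 : 0 < k + 1 := Nat.succ_pos k
  have hqnear : q ∈ plaqsOf (maxDomT ν.M₁ (cubeEnl (F.P p.K) (sideχ F ν p g k) c 4) 1) :=
    plaqInside_cubeEnl_one_subset_plaqsOf hM hsz _ hq
  have hn1 : (1 : ℝ) ≤ (((F.P p.K).d ^ 2 * (9 * sideχ F ν p g k) ^ (F.P p.K).d : ℕ) : ℝ) := by
    classical
    have hc := card_filter_plaqsOf_maxDomT_one_le (P := F.P p.K) hM hdiv hk0 (sideχ F ν p g k) (c : Pt (F.P p.K).d)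
    have hpos : 0 < (Finset.univ.filter fun q' : Plaq (F.P p.K) 0 =>
        q' ∈ plaqsOf (maxDomT ν.M₁ (cubeEnl (F.P p.K) (sideχ F ν p g k) c 4) 1)).card :=
      Finset.card_pos.2 ⟨q, Finset.mem_filter.2 ⟨Finset.mem_univ _, hqnear⟩⟩
    exact_mod_cast hpos.trans_le hc
  have hN1 : (1 : ℝ) ≤ N := by exact_mod_cast Nat.one_le_iff_ne_zero.2 (NeZero.ne N)
  have hΛ1 : 1 ≤ Λ := by
    rw [hΛ, show (1 : ℝ) = Real.sqrt 1 by rw [Real.sqrt_one]]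
    exact Real.sqrt_le_sqrt (by nlinarith)
  have hεreg : epsOfRecord ν g (k + 1) / B ≤ ν.εreg * (F.P p.K).eta (k + 1) ^ 2 := by
    have h1 : epsOfRecord ν g (k + 1) / B ≤ Λ * (epsOfRecord ν g (k + 1) / B) := le_mul_of_one_le_left hε.le hΛ1
    have h2 : epsOfRecord ν g (k + 1) * (F.P p.K).eta (k + 1) ^ 2 ≤ ν.εreg * (F.P p.K).eta (k + 1) ^ 2 :=
      mul_le_mul_of_nonneg_right hnd.le hη.le
    linarith
  exact (plaqSmallOn_of_isMinimizer_crude F N ν p g hk hM hdiv hsz c hε hεreg hmin hV' q hq).trans_le hmain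

open Classical in
/-- ★★ **`hreg` AT THE CANONICAL REGIONS, DISCHARGED** (module 49 §3 `hreg_canon_of_regularity` ∘ `hThm1_of_crude`): for `B ≥ B_k` the lineage's regularity letter
«`V′` `(ε_{k+1}∕B)`-small on `R♮_k(c)` ⇒ `χ_{k+1}(c)(V′) = 1`» holds at EVERY χ_{k+1}-cube — no displayed hypothesis of [Balaban1985Variational]'s kind left at a
fixed level (the level-uniform `B` is Thm 1 (8), NOT claimed). [cite: Balaban1985Variational, Thm 1 (9) p.279; Balaban1988Convergent, (2.16)–(2.17) p.257, (3.2) p.265] -/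
theorem hreg_canon_of_crude {k : ℕ} (hk : k + 1 ≤ (F.P p.K).m + (F.P p.K).K) (hM : 1 ≤ ν.M₁)
    (hdiv : side (F.P p.K).L ν.M₁ (k + 1) ∣ (F.P p.K).sitesPerDir 0) (hsz : side (F.P p.K).L ν.M₁ 1 ≤ sideχ F ν p g k)
    {B : ℝ} (hB0 : 0 < B) (hεk : 0 < epsOfRecord ν g (k + 1))
    (hεη : 0 < epsOfRecord ν g (k + 1) * (F.P p.K).eta (k + 1) ^ 2)
    (hB : Real.sqrt ((N : ℝ) * (((F.P p.K).d ^ 2 * (9 * sideχ F ν p g k) ^ (F.P p.K).d : ℕ) : ℝ)) ≤ B * (F.P p.K).eta (k + 1) ^ 2) :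
    ∀ (c : Iχ F ν p g k) (V' : GaugeField (F.P p.K) (k + 1) (SU N)),
      (∀ p' ∈ (Finset.univ.filter fun q : Plaq (F.P p.K) (k + 1) => embIter (k + 1) q.src ∈ cubeEnl (F.P p.K) (sideχ F ν p g k) c 4),
        dist1 (GaugeField.plaqHol V' p') < epsOfRecord ν g (k + 1) / B) → chiFactor F N ν p g k c V' = 1 :=
  fun c => hreg_canon_of_regularity F N ν p g k c hεη _ (hThm1_of_crude F N ν p g hk hM hdiv hsz hB0 hεk hB c)

end Crude

end Summit.QuantumFields.YangMills.BalabanUVNodes.N20LCSMinimiserEnergyComparison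

end
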